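import Mathlib
import Summits.NavierStokesRegularity.NavierStokesRegularity.Theses.BernoulliDeceleration
import HarnessLib

/-!
# `BernoulliDeceleration.Assembly` — the route's assembly (item stmt-NavierStokesRegularity-3038;
  pure logic)

**Statement.** `OneSidedHeadRegularity → HeadPeaksDecelerate → DeceleratingSetHeadBound →
NoBlowupToClay → NavierStokesRegularity`.

PROOF. The route file `Theses/BernoulliDeceleration.lean` carries the planner-authored,
kernel-checked deciding theorem `Theses.BernoulliDeceleration.closes`, whose hypotheses are exactly
the route's items and whose conclusion is the registered leaf; the assembly item is that implication
written as ONE proposition, so it is closed by applying `closes` to the hypotheses (in the order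
`closes` expects).

HONEST FRAMING: glue between the route's own statements (about HYPOTHETICAL objects); nothing
here bears on the regularity problem itself.
-/

noncomputable section

set_option linter.dupNamespace false

namespace Summit.NavierStokesRegularity.NavierStokesRegularity.Theorems

open Summit.NavierStokesRegularity.NavierStokesRegularity.Theses.BernoulliDeceleration in
/-- **Item stmt-NavierStokesRegularity-3038** (`BernoulliDeceleration.Assembly`): the route's chain
of items implies its registered leaf, by the route file's deciding theorem `closes`. [this file] -/
theorem bernoulliDeceleration_assembly_proof :
    Summit.NavierStokesRegularity.NavierStokesRegularity.Theses.BernoulliDeceleration.Assembly := by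
  unfold Summit.NavierStokesRegularity.NavierStokesRegularity.Theses.BernoulliDeceleration.Assembly
  intro hSS hPeak hX hClay
  exact closes hX hSS hClay hPeak

end Summit.NavierStokesRegularity.NavierStokesRegularity.Theorems

end
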